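import Summits.BirchSwinnertonDyer.BirchSwinnertonDyer.Theorems.SignedLowerHalvesKobayashiLowerHalfLargeImageKuriharaRigidityThm74
import HarnessLib

/-!
# Kobayashi 2003 Thm. 7.4 (ii) at the trivial character, IN THE KERNEL, at EVERY ODD good supersingular
# prime — in particular `p = 3`: Kato's main conjecture (resp. its Eisenstein half) on the `η = 1`
# Coleman/Kato package gives `KobayashiMainConjecture W p ε` (resp. `KobayashiLowerDivisibility W p ε`)
# (route `SignedLowerHalves`, crux `KobayashiLowerHalfLargeImage` = item stmt-BirchSwinnertonDyer-19001, line
# `kurihara_rigidity`; cell `bsd-ssimc`, seat `bsd-line-slh-p1` lead gen 2; a `--supports … --as helper` file)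

WHAT. The w2 seat's `…KuriharaRigidityThm74.lean` (p607446) proved the two FRAME THEOREMS
`kobayashiMainConjecture_of_katoMainConjectureFrame` / `kobayashiLowerDivisibility_of_katoEisensteinFrame` under
`5 ≤ p`. Their ONLY use of `5 ≤ p` is the period valuation `ord_p(Ω⁺_f/Ω(W)) = 0`, taken from the named fact
`realPeriodRat_eq_unit_mul_plusPeriod` (Greenberg–Vatsal Rem. 3.4 with Abbes–Ullmo / Mazur at a good `p ≥ 5`).
The tree ALSO holds that comparison at `p = 3` — `realPeriodRat_eq_unit_mul_plusPeriod_three` (Mazur 1978 Cor.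
4.1 at `3 ∤ N`) — and the combined valuation lemma `Rank1Residual.padicValRat_periodRatio_eq_zero` for every ODD
good `p` with `E[p]` irreducible; Kobayashi's paper and the package fact
`Kobayashi2003.thm62_63_73_signedColemanKato_zeta` carry `p ≠ 2` only. This file re-runs the two frames with
`p ≠ 2` in place of `5 ≤ p` (one line changes: the period valuation), so that line `kurihara_rigidity`'s
`p = 3` engine («Kim–Kim–Sun 2020 Thm 1.1 at `p = 3` ∘ Kobayashi 7.4», binder
`KimKimSun2020_thm11_via_kobayashi74_three` of `Rank1Residual/Supersingular/KobayashiMainConjectureKuriharaRigidityThree.lean`)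
can later be DERIVED from a Kato-side fact on the package exactly as `…KuriharaRigidityBindersOfFacts.lean`
(p608428) derived the `p ≥ 5` binders — Kobayashi 7.4 on faith nowhere at `p = 3` either.

* `exists_fourTerm_data_of_signedColemanKato_odd` — the common core (data assembly of Kobayashi p. 13 at
  `η = 1`) for `p ≠ 2`, the period unit entering through BOTH named facts (`h5` at `p ≥ 5`, `h3` at `p = 3`).
* `kobayashiMainConjecture_of_katoMainConjectureFrame_odd`, `kobayashiLowerDivisibility_of_katoEisensteinFrame_odd`
  — the two frames at every odd good supersingular `p` with `a_p = 0` and `E[p]` irreducible.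

HONEST FRAMING (cell `bsd-ssimc`, HOME `run/shared/lean/pub/bsd-ssimc/`): TOOL THEOREMS ONLY — no definition, no
named fact minted, no `sorry`, axioms standard; the frames `hK` are DISPLAYED (Kato's main conjecture is OPEN
class-wide); `h12`, `h5`, `h3` are named published facts. Nothing closes; crux, line and route stay OPEN; BSD is
not proved by any of this. The `Λ`-algebra (§1 of the w2 file) is imported, not restated.

References: [Kobayashi2003] Thm. 1.2, §4–§5, Thm. 6.2/6.3, Prop. 7.1, Thm. 7.3 (7.21), Thm. 7.4 (p. 13);
[Kato2004Asterisque] §12.2, Thm. 12.4–12.6, Conj. 12.10; [GreenbergVatsal2000] §3 Rem. 3.4; [Mazur1978] Cor. 4.1;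
[AbbesUllmo1996] Thm. A; [Pollack2003] Cor. 5.11; [NeukirchSchmidtWingberg2008] Ch. V §3.
-/

set_option autoImplicit false
-- single-problem summit (D-0017): the doubled namespace component is by design
set_option linter.dupNamespace false

noncomputable section

open scoped Classical MatrixGroups ModularForm

open CongruenceSubgroup Field WeierstrassCurve Literature.NumberTheory.EllipticCurves
  Literature.NumberTheory.EllipticCurves.ModularForms Literature.NumberTheory.GaloisRepresentations
  Literature.NumberTheory.EllipticCurves.Rank1Residual Summit.BirchSwinnertonDyer.Rank1Residual.Supersingular

namespace Summit.BirchSwinnertonDyer.BirchSwinnertonDyer.Theorems.KuriharaRigidity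

section FrameOdd

variable (W : WeierstrassCurve ℚ) [W.IsElliptic] [W.IsGloballyMinimal] (p : ℕ) [Fact p.Prime]
  [ContinuousSMul ℤ_[p] (W.tateModule p)] [Module.Free ℤ_[p] (W.tateModule p)]
  [Module.Finite ℤ_[p] (W.tateModule p)]

/-- **Common core of the two frame theorems at an ODD prime** (Kobayashi p. 13 at `η = 1`, data assembly; the
`p ≠ 2` twin of `exists_fourTerm_data_of_signedColemanKato`): for a frame of `KobayashiMainConjecture W p ε`
(cyclotomic `(κ, γ)`, newform `f`, period ratio `ϖ`, Pollack pair, dual datum `D`), a pinned fine dual `Y` and a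
package datum `d` on a pinned `I`, at an ODD good `p` with `a_p = 0` and `E[p]` irreducible, GRANTED Thm. 1.2
(`h12`) and the period unit at `p ≥ 5` (`h5`) AND at `p = 3` (`h3`): `D.X` and `Y.X` are torsion, and there are
`G₁ ∈ Λ` with `ι G₁ = C(ϖ)·ι L^ε` (`L^ε = kobayashiL ε L⁺ L⁻`, NÉRON-normalised `L_p^ε`), `char(Λ/col Z) = (G₁)`
with `Λ/col Z` torsion, and the exact `0 → I.H/d.Z → Λ/col Z → D.X → Y.X → 0`. Proof verbatim as the `p ≥ 5`
core except that `ord_p ϖ = 0` comes from `Rank1Residual.padicValRat_periodRatio_eq_zero h5 h3`.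
[cite: Kobayashi2003, proof of Thm. 7.4 (p. 13), Thm. 7.3 i) (7.21), Thm. 6.3 (p. 11), Thm. 1.2 (p. 2), (3.4)–(3.6) (p. 7)]
[cite: GreenbergVatsal2000, §3, Remark 3.4] [cite: Mazur1978, Cor. 4.1] [cite: Pollack2003, Cor. 5.11 and Prop. 6.18] -/
theorem exists_fourTerm_data_of_signedColemanKato_odd
    (h12 : Kobayashi2003.thm12_signedSelmerDual_finite_torsion)
    (h5 : realPeriodRat_eq_unit_mul_plusPeriod) (h3 : realPeriodRat_eq_unit_mul_plusPeriod_three)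
    (hp2 : p ≠ 2) (hgood : W.HasGoodReductionAtPrime p) (hap : W.frobeniusTrace p = 0)
    (hirr : W.HasIrreducibleModPGaloisRep p) {ε : ℤˣ}
    {κ : ZpExtension ℚ p} {γ : absoluteGaloisGroup ℚ} (hκ : κ.IsCyclotomic) (hγ : κ.IsTopGenerator γ)
    {N : ℕ} [NeZero N] {f : CuspForm (Gamma0 N) 2} (hf : IsNewformOf W f)
    {ϖ : ℚ} (hϖ : (ϖ : ℝ) * W.realPeriodRat = plusPeriod f)
    {Lplus Lminus : IwasawaAlgebra p} (hL : IsPollackPair f p Lplus Lminus)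
    (D : Kobayashi2003.SignedSelmerDualData W κ γ ε) {I : Kato2004.IwasawaH1Data W p κ γ}
    (Y : W.FineSelmerDualData κ γ) (d : Kobayashi2003.SignedColemanKatoData W p f ϖ κ γ ε I) :
    Module.IsTorsion (IwasawaAlgebra p) D.X ∧ Module.IsTorsion (IwasawaAlgebra p) Y.X ∧
    ∃ G₁ : IwasawaAlgebra p,
      iwasawaToPowerSeries p G₁ =
        PowerSeries.C ((ϖ : ℚ) : ℚ_[p]) * iwasawaToPowerSeries p (kobayashiL ε Lplus Lminus) ∧
      Module.charIdeal (IwasawaAlgebra p) (IwasawaAlgebra p ⧸ (d.Z.map d.col : Ideal (IwasawaAlgebra p))) =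
        Ideal.span {G₁} ∧
      Module.IsTorsion (IwasawaAlgebra p) (IwasawaAlgebra p ⧸ (d.Z.map d.col : Ideal (IwasawaAlgebra p))) ∧
      ∃ (i : (I.H ⧸ d.Z) →ₗ[IwasawaAlgebra p]
            (IwasawaAlgebra p ⧸ (d.Z.map d.col : Ideal (IwasawaAlgebra p))))
        (j' : (IwasawaAlgebra p ⧸ (d.Z.map d.col : Ideal (IwasawaAlgebra p))) →ₗ[IwasawaAlgebra p] D.X)
        (k' : D.X →ₗ[IwasawaAlgebra p] Y.X),
        Function.Injective i ∧ Function.Exact i j' ∧ Function.Exact j' k' ∧ Function.Surjective k' := by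
  -- Kobayashi Thm. 1.2: `X^ε` is finitely generated torsion
  obtain ⟨-, hDtor⟩ := h12 W p hp2 hgood hap κ γ hκ hγ ε D
  -- Kobayashi's `L_p^ε` (non-zero, Pollack) and its Néron normalisation `G₁ = C(u)·L ∈ Λ`
  set L : IwasawaAlgebra p := kobayashiL ε Lplus Lminus with hLdef
  have hLsgn : Kobayashi2003.IsSignedPAdicLFunction f p ε L := hL.isSignedPAdicLFunction_kobayashiL ε
  have hL0 : L ≠ 0 := by
    rw [hLdef, kobayashiL]
    split_ifs
    · exact hL.2.1
    · exact hL.1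
  have hϖ0 : ϖ ≠ 0 := by
    rintro rfl
    rw [Rat.cast_zero, zero_mul] at hϖ
    exact (IsNewform0.plusPeriod_pos_holds hf.1 hf.coeffField_eq_bot).ne hϖ
  have hvϖ : padicValRat p ϖ = 0 :=
    Rank1Residual.padicValRat_periodRatio_eq_zero h5 h3 W p hp2 hgood hirr f hf ϖ hϖ
  obtain ⟨u, hu⟩ := exists_units_coe_eq_ratCast hϖ0 hvϖ
  set G₁ : IwasawaAlgebra p := PowerSeries.C (u : ℤ_[p]) * L with hG₁def
  have hG₁ : iwasawaToPowerSeries p G₁ =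
      PowerSeries.C (((ϖ : ℚ) : ℚ_[p])) * iwasawaToPowerSeries p L := by
    rw [hG₁def, map_mul, ← hu]
    congr 1
    rw [PowerSeries.map_C]
    rfl
  have hCu : (PowerSeries.C (u : ℤ_[p]) : IwasawaAlgebra p) ≠ 0 := by
    rw [Ne, ← map_zero (PowerSeries.C (R := ℤ_[p])), (PowerSeries.C_injective).eq_iff]
    exact Units.ne_zero u
  have hG₁0 : G₁ ≠ 0 := mul_ne_zero hCu hL0
  -- `J = col(Z)`; `char(Λ/J) = (G₁)` from Thm. 6.3 on ideals at every height-one prime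
  set J : Ideal (IwasawaAlgebra p) := d.Z.map d.col with hJdef
  have hloc : ∀ 𝔭 : PrimeSpectrum (IwasawaAlgebra p), 𝔭.asIdeal.height = 1 →
      ∃ s : IwasawaAlgebra p, s ∉ 𝔭.asIdeal ∧ s * G₁ ∈ J ∧
        ∀ x ∈ J, s * x ∈ Ideal.span {G₁} := by
    intro 𝔭 h𝔭
    obtain ⟨s, hs𝔭, hsG, hsZ⟩ := d.image_zeta_localized hirr L G₁ hLsgn hG₁ 𝔭 h𝔭
    refine ⟨s, hs𝔭, hsG, fun x hx => ?_⟩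
    obtain ⟨z, hz, rfl⟩ := Submodule.mem_map.mp hx
    exact hsZ z hz
  have hcharJ : Module.charIdeal (IwasawaAlgebra p) (IwasawaAlgebra p ⧸ J) = Ideal.span {G₁} := by
    rw [← Module.charIdeal_quotient_span_singleton hG₁0]
    unfold Module.charIdeal
    refine finprod_mem_congr rfl fun 𝔭 h𝔭 => ?_
    obtain ⟨s, hs𝔭, hsG, hsJ⟩ := hloc 𝔭 h𝔭
    rw [lengthAt_quotient_eq_of_localized 𝔭 hs𝔭 (J₁ := J) (J₂ := Ideal.span {G₁}) ?_ hsJ]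
    intro x hx
    obtain ⟨r, rfl⟩ := Ideal.mem_span_singleton'.mp hx
    rw [← mul_assoc, mul_comm s r, mul_assoc]
    exact J.mul_mem_left r hsG
  -- `Λ/J` is torsion: `J ∋ s₀·G₁ ≠ 0` at the height-one prime `(p)`
  let 𝔭₀ : PrimeSpectrum (IwasawaAlgebra p) :=
    ⟨IwasawaAlgebra.augIdealP p, IwasawaAlgebra.isPrime_augIdealP_holds p⟩
  obtain ⟨s₀, hs₀, hs₀G, -⟩ := hloc 𝔭₀ (by exact IwasawaAlgebra.height_augIdealP_holds p)
  have hs₀0 : s₀ ≠ 0 := by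
    rintro rfl
    exact hs₀ (zero_mem _)
  have hQtor : Module.IsTorsion (IwasawaAlgebra p) (IwasawaAlgebra p ⧸ J) :=
    isTorsion_quotient_of_mem hs₀G (mul_ne_zero hs₀0 hG₁0)
  -- (7.21) for `D`, `Y`, and the four-term sequence
  obtain ⟨j, k, hcj, hjk, hk⟩ := d.exact D Y
  obtain ⟨i, j', k', hi, hij, hjk', hk'⟩ :=
    exists_fourTermExact_of_threeTermExact_submodule d.col j k d.col_injective hcj hjk hk d.Z
  exact ⟨hDtor, isTorsion_of_surjective hDtor k' hk', G₁, hG₁, hcharJ, hQtor, i, j', k', hi, hij, hjk',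
    hk'⟩

/-- **Kobayashi 2003 Thm. 7.4 (ii), «Kato's main conjecture ⟹ the signed main conjecture of sign `ε`», AT
`η = 1`, IN THE KERNEL, at every ODD good supersingular prime with `a_p = 0`** (in particular `p = 3`, where
`a₃ = 0` is a genuine condition). `W/ℚ` globally minimal, `p ≠ 2` good with `a_p = 0`, `E[p]` irreducible, `ε`
a sign; GRANTED Kobayashi Thm. 1.2 (`h12`) and the period unit at `p ≥ 5` (`h5`) and at `p = 3` (`h3`), all
PUBLISHED. DISPLAYED FRAME `hK` = KATO'S MAIN CONJECTURE for `T_pE` over `ℚ_∞` read on the `η = 1` package (as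
in `kobayashiMainConjecture_of_katoMainConjectureFrame`): `char_Λ(Y.X) = char_Λ(I.H ⧸ d.Z)` for all pinned
`I`, `Y` and some package datum `d`. CONCLUSION `KobayashiMainConjecture W p ε`. CONDITIONAL on `hK`, `h12`,
`h5`, `h3`; closes nothing. [cite: Kobayashi2003, Thm. 7.4 and its proof (p. 13), §5 (p. 10), §4 (p. 8)]
[cite: Kato2004Asterisque, Conj. 12.10 (p. 224)] [cite: Mazur1978, Cor. 4.1] [cite: NeukirchSchmidtWingberg2008, Ch. V §3] -/
theorem kobayashiMainConjecture_of_katoMainConjectureFrame_odd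
    (h12 : Kobayashi2003.thm12_signedSelmerDual_finite_torsion)
    (h5 : realPeriodRat_eq_unit_mul_plusPeriod) (h3 : realPeriodRat_eq_unit_mul_plusPeriod_three)
    (hp2 : p ≠ 2) (hgood : W.HasGoodReductionAtPrime p) (hap : W.frobeniusTrace p = 0)
    (hirr : W.HasIrreducibleModPGaloisRep p) (ε : ℤˣ)
    (hK : ∀ (κ : ZpExtension ℚ p) (γ : absoluteGaloisGroup ℚ),
        κ.IsCyclotomic → κ.IsTopGenerator γ → IsCyclotomicVariable p γ →
      ∀ [NeZero (W.conductorNorm ℤ)] (f : CuspForm (Gamma0 (W.conductorNorm ℤ)) 2),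
        IsNewformOf W f → ∀ (ϖ : ℚ), (ϖ : ℝ) * W.realPeriodRat = plusPeriod f →
      ∀ (I : Kato2004.IwasawaH1Data W p κ γ) (Y : W.FineSelmerDualData κ γ),
        ∃ d : Kobayashi2003.SignedColemanKatoData W p f ϖ κ γ ε I,
          Module.charIdeal (IwasawaAlgebra p) Y.X =
            Module.charIdeal (IwasawaAlgebra p) (I.H ⧸ d.Z)) :
    KobayashiMainConjecture W p ε := by
  intro κ γ hκ hγ hγc _ f hf ϖ hϖ Lplus Lminus hL D
  -- pin `𝐇¹_Γ(T_pW)` and `X₀(W/ℚ_∞)`, take the package datum carrying Kato's main conjecture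
  obtain ⟨I⟩ := Kato2004.nonempty_iwasawaH1Data_holds W p κ γ hκ hγ
  obtain ⟨Y⟩ := W.nonempty_fineSelmerDualData κ hγ
  haveI : Module.Finite (IwasawaAlgebra p) Y.X :=
    WeierstrassCurve.FineSelmerDualData.module_finite _ κ hγ Y
  obtain ⟨d, hIMC⟩ := hK κ γ hκ hγ hγc f hf ϖ hϖ I Y
  obtain ⟨hDtor, hYtor, G₁, hG₁, hcharJ, hQtor, i, j', k', hi, hij, hjk', hk'⟩ :=
    exists_fourTerm_data_of_signedColemanKato_odd W p h12 h5 h3 hp2 hgood hap hirr hκ hγ hf hϖ hL D Y d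
  have hchar := (charIdeal_eq_of_fourTermExact hQtor hYtor i j' k' hi hij hjk' hk').1 hIMC.symm
  refine ⟨hDtor, G₁, ?_, hG₁⟩
  change Module.charIdeal (IwasawaAlgebra p) D.X = Ideal.span {G₁}
  rw [hchar, hcharJ]

/-- **The EISENSTEIN half at every ODD good supersingular prime with `a_p = 0`: Kato's LOWER inclusion
`Char X₀ ⊆ Char(𝐇¹/Z)` on the `η = 1` package ⟹ `KobayashiLowerDivisibility W p ε`** — the decl the crux
`KobayashiLowerHalfLargeImage` asks for (one sign), at `p = 3` included. Same frame as
`kobayashiMainConjecture_of_katoMainConjectureFrame_odd`, displayed hypothesis weakened to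
`char_Λ(Y.X) ⊆ char_Λ(I.H ⧸ d.Z)`. Along the four-term sequence `Char X^ε ⊆ char(Λ/col Z) = (ϖ·L_p^ε)`, and
`Char X^ε = (g)` is principal (`charIdeal_isPrincipal_holds`), so `ι g = ϖ·ι(L_p^ε·h)`. CONDITIONAL on `hK`, `h12`,
`h5`, `h3`; closes nothing. [cite: Kobayashi2003, proof of Thm. 7.4 (p. 13), §4 (p. 8)]
[cite: Kato2004Asterisque, Conj. 12.10 (p. 224), Thm. 12.5 (4) (p. 222)] [cite: Mazur1978, Cor. 4.1]
[cite: NeukirchSchmidtWingberg2008, Ch. V §3] -/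
theorem kobayashiLowerDivisibility_of_katoEisensteinFrame_odd
    (h12 : Kobayashi2003.thm12_signedSelmerDual_finite_torsion)
    (h5 : realPeriodRat_eq_unit_mul_plusPeriod) (h3 : realPeriodRat_eq_unit_mul_plusPeriod_three)
    (hp2 : p ≠ 2) (hgood : W.HasGoodReductionAtPrime p) (hap : W.frobeniusTrace p = 0)
    (hirr : W.HasIrreducibleModPGaloisRep p) (ε : ℤˣ)
    (hK : ∀ (κ : ZpExtension ℚ p) (γ : absoluteGaloisGroup ℚ),
        κ.IsCyclotomic → κ.IsTopGenerator γ → IsCyclotomicVariable p γ →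
      ∀ [NeZero (W.conductorNorm ℤ)] (f : CuspForm (Gamma0 (W.conductorNorm ℤ)) 2),
        IsNewformOf W f → ∀ (ϖ : ℚ), (ϖ : ℝ) * W.realPeriodRat = plusPeriod f →
      ∀ (I : Kato2004.IwasawaH1Data W p κ γ) (Y : W.FineSelmerDualData κ γ),
        ∃ d : Kobayashi2003.SignedColemanKatoData W p f ϖ κ γ ε I,
          Module.charIdeal (IwasawaAlgebra p) Y.X ≤
            Module.charIdeal (IwasawaAlgebra p) (I.H ⧸ d.Z)) :
    KobayashiLowerDivisibility W p ε := by
  intro κ γ hκ hγ hγc _ f hf ϖ hϖ Lplus Lminus hL D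
  obtain ⟨I⟩ := Kato2004.nonempty_iwasawaH1Data_holds W p κ γ hκ hγ
  obtain ⟨Y⟩ := W.nonempty_fineSelmerDualData κ hγ
  haveI : Module.Finite (IwasawaAlgebra p) Y.X :=
    WeierstrassCurve.FineSelmerDualData.module_finite _ κ hγ Y
  obtain ⟨d, hEis⟩ := hK κ γ hκ hγ hγc f hf ϖ hϖ I Y
  obtain ⟨-, hYtor, G₁, hG₁, hcharJ, hQtor, i, j', k', hi, hij, hjk', hk'⟩ :=
    exists_fourTerm_data_of_signedColemanKato_odd W p h12 h5 h3 hp2 hgood hap hirr hκ hγ hf hϖ hL D Y d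
  have hle := (charIdeal_eq_of_fourTermExact hQtor hYtor i j' k' hi hij hjk' hk').2 hEis
  rw [hcharJ] at hle
  -- `Char X^ε = (g)` is principal and `(g) ⊆ (G₁)`: `g = G₁ · h`
  obtain ⟨g, hg⟩ := (charIdeal_isPrincipal_holds p D.X).principal
  have hg' : Module.charIdeal (IwasawaAlgebra p) D.X = Ideal.span {g} := hg
  rw [hg', Ideal.span_singleton_le_iff_mem, Ideal.mem_span_singleton'] at hle
  obtain ⟨h, hh⟩ := hle
  refine ⟨g, h, ?_, ?_⟩
  · change Module.charIdeal (IwasawaAlgebra p) D.X = Ideal.span {g}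
    exact hg'
  · rw [← hh, mul_comm h G₁, map_mul, hG₁, map_mul, mul_assoc]

end FrameOdd

end Summit.BirchSwinnertonDyer.BirchSwinnertonDyer.Theorems.KuriharaRigidity

end
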